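import Summits.QuantumFields.BalabanUV.Beta.GAN24.CubicReadoutCoDressed
import Summits.QuantumFields.BalabanUV.Beta.GAN24.LinT2ZeroMode
import Summits.QuantumFields.BalabanUV.Beta.GAN24.T2RecursionAffine

/-!
# `BalabanUV.Beta.GAN24.LinT2CoDressed` — binder row G-an2-4 ∕ (CONV-C), CT-W (W-slot rows of the DRESSED wall family; the row owner's «CT-W DESIGN v0» RULING
# R-gan24p1-g22-1, route (R-HYB)+(R-CT), prelude to CT-W1 `SandwichLegTelescope`): **CO-DRESSING THE RESOLVENT IS DRESSING THE TABLE inside `vertexOfK`, `vertex2OfK`,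
# `vsym`, `linT2`, `lin4`** — the second-order twin of the row owner's `CubicReadoutCoDressed.e3K_coDressKBmAt` ∕ an2's `vertexOfK_dressBmAt_S`

NOT IN PRINT; OUR BOOKKEEPING (G-an2-4 formalisation swarm, leaf prover `b2b-balaban-gan24-formalise-leaf-06`, gen 42; journal OFFER O-leaf06g42-1 l.37044 = PART 3a of
leaf-02 g51's located finding [LEAF02-G51-INTENT1] l.36961 (reached independently here); the row owner's `HOME/b2b-balaban-gan24-p1/gen22/CT-W-DESIGN-v0.md` §2–§3; module
name PROVISIONAL — the row owner may rename ∕ re-home it).  HONEST FRAMING (cell contract, verbatim): «discharging `BetaPertH` makes Bałaban's UV stability UNCONDITIONAL — a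
real constructive-QFT result; it is NOT the continuum limit and NOT the Clay problem.»  HONEST DEPENDENCY (verbatim): «continuum YM on T⁴ ⇐ BetaPertH ∧ nine spine estimates
(0/9 proved); BetaPertH ⇐ (D1) ∧ (D4) ∧ CAP+tail; G-an2-4 gates asym, D1 and NE2/3/4.»

WHY.  The `T₂`-linear part of the DRESSED step (`SpineRecursiveW` §3; p2's (F1) `T2RecOfUnitSplit` p308181) is leaf-04's `lin4 c G̃_j Lc` with the CO-DRESSED resolvent
`G_j = coDressKBmAt ρ Lc (KInvStep Lc j) = Πᵀ_bm ∘ K_j ∘ Π_bm` where road «W3» (closed, undressed) has `K♮_j`.  For ANY decaying `K`, ANY `LocStencil₂` table `X`, ANY in-block root, the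
co-dressing moves OFF the resolvent ONTO the table by ONE fixed (`j`-free, `K`-free) linear operation `𝔇` = «`Πᵀ_bm` on both source slots (an2's `coProjBmAtK`), then
`Π_bm ∘ · ∘ Πᵀ_bm` on the kernel legs (an2's `dressKBmAt`)»: `linT2 (coDressKBmAt ρ N K) N X = linT2 K N (𝔇 X)` and `lin4 c (coDressKBmAt ρ N K) N X = lin4 c K N (𝔇 X)`.  So every
factor of the dressed composite transport `P^E` is `lin4_{K♮} ∘ 𝔇`; `P^E − P^B` telescopes into terms with exactly ONE factor `lin4_{K♮} ∘ (𝔇 − 1)`, and `𝔇 − 1` is, slot by slot,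
leaf-02 g51's dressing defect (`CoProjBmDivFree`: `Πᵀ_bm g − g = Σ' φ·div g`) — the design's (R-CT) «sandwiches with exactly one leg differenced».  ZERO-MODE READING (leaf-02's, not typed
here): by their (Z0) at `K♮_j`, `zmode 1 (lin4 c G̃_j Lc X) = (undressed eigenvalue)·zmode Lc (𝔇 X)`, and `Π_bm` does NOT fix constants (gan24-p4's `PiBmConstants.axProjBmAt_const`) ⇒
`zmode Lc (𝔇 X) ≠ zmode Lc X` in general: the obstruction to (R-W3-dressed) is exactly «`𝔇` does not preserve `Zfree`».

WHAT ([folklore] kernel algebra BY NAME; generic `d`, `1 ≤ N`, in-block root `ρ = toSite r`; 0 `def`, 0 cite, 0 `def … : Prop`, 0 sorry):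
§1 `locStencil_slice`; `vertexOfK_coDressKBmAt : vertexOfK (coDressKBmAt ρ N K) N S μ y = vertexOfK K N (coProjBmAtK ρ N S) μ y` (an2's `vertexOfK_coProjBmAtK` + `colH_coDressKBmAt_eq`).
§2 `locStencil₂_coProj_snd ∕ _fst`, `locStencil₂_dress` (window constants, same rate); `vertexOfK_finset_sum_mul`; `locStencil_vertexOfK_slice`.
§3 **`vertex2OfK_coDressKBmAt`**: `vertex2OfK (coDressKBmAt ρ N K) N X μ y ν y′ = vertex2OfK K N X̂ μ y ν y′`, `X̂ κ u κ′ u′ := coProjBmAtK ρ N (fun κ₁ u₁ ↦ coProjBmAtK ρ N (X κ₁ u₁) κ′ u′) κ u`.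
§4 `dressKBmAt_add ∕ _smul`, `vertex2OfK_dress`, **`linT2_coDressKBmAt`**, **`vsym_coDressKBmAt`**, **`lin4_coDressKBmAt`** (`𝔇 X κ u κ′ u′ := dressKBmAt ρ N (X̂ κ u κ′ u′)`; the row owner's
`mmRead_sandwich_coDressKBmAt` + an2's `vertexOfK_dressKBmAt` twice).
PART 2 (`GAN24/LinT2CoDressedStep`): the adopted-units ∕ comb instance `lin4 c (unitK (sfStep Lc j) (smStep d Lc j) (coDressKBmAt ρ Lc (KInvStep Lc j))) Lc X = lin4 c K♮_j Lc (𝔇 X)`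
— the dressed tower's linear map IS road W3's `𝒜_j` on the leg-dressed table — and the joint block covariance of `𝔇 X`.
Asserts NO shape or rate of Bałaban's tables; discharges NOTHING of «T2Shape» ∕ «T2Drift» ∕ (hW, hWall); 0 wall binders; NEVER «G-an2-4 closed» as (CONV-C); NOT D1, NOT `BetaPertH`,
NOT continuum, NOT Clay; not in print — our bookkeeping.  Unit `b2b-balaban-gan24-formalise-leaf-06` (gen 42), 2026-08-21.
-/

noncomputable section

open Finset
open scoped BigOperators
open Literature.MathematicalPhysics.QuantumFieldTheory
open Literature.MathematicalPhysics.QuantumFieldTheory.Balaban1983to89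
open Literature.MathematicalPhysics.QuantumFieldTheory.Balaban1983to89.Beta
open B12Sec2to5 (l1 l1_nonneg)
open ExpKernelCalculus (MKer Site Decays BiLoc VertexFamily₂ comp shiftK l1_sub_triangle l1_sub_symm Zl Zl_nonneg)
open AffineAveraging (Form1 box toSite)
open OneStepResolventKernel (Fib wsum LocStencil bound_mono biLoc_mono)
open OneStepKernelFamily (colH abs_colH_le vertexOfK)
open BalabanCompositeJets (LocStencil₂)
open SecondOrderResponse (vertex2OfK biLoc_vertexOfK_slice vertexFamily₂_vertex2OfK cBi)
open BalabanStepJetsSucc (mmRead)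
open AxialDressing (summable_colH_mul_stencil)
open Summit.QuantumFields.BalabanUV.Beta.TameKernelCalculus
open Summit.QuantumFields.BalabanUV.Beta.AxialDressingRooted (pmBm cube l1_le_of_mem_cube coProjBmAt coProjBmAt_apply abs_coProjBmAt_le
  coProjBmAt_shift cWb cWb_nonneg cKb cKb_nonneg coProjBmAtK coProjBmAtK_eval coDressKBmAt dressKBmAt biLoc_dressKBmAt dressKBmAt_shiftK
  coProjBmW colH_coDressKBmAt_eq vertexOfK_coProjBmAtK vertexOfK_dressKBmAt locStencil_coProjBmAtK cKb' cKb'_nonneg decays_coDressKBmAt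
  one_le_of_neZero)
open Summit.QuantumFields.BalabanUV.Beta.GAN24.CubicReadoutCoDressed (mmRead_sandwich_coDressKBmAt)
open Summit.QuantumFields.BalabanUV.Beta.GAN24.BiStencilZeroMode (Tab)
open Summit.QuantumFields.BalabanUV.Beta.GAN24.LinT2ZeroMode (linT2)
open Summit.QuantumFields.BalabanUV.Beta.GAN24.T2RecursionAffine (lin4 vsym)

namespace Summit.QuantumFields.BalabanUV.Beta.GAN24.LinT2CoDressed

variable {d : ℕ}

/-! ## §1 Slices of a bi-stencil table; the first-order exchange restated with the co-dressed kernel on the left -/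

/-- [folklore] A SLICE `X κ u` of a `LocStencil₂` table, read as a stencil family in its second bond, is a local stencil family at half the rate
(the same constant): `|X κ u κ′ u′ x z a b| ≤ C·e^{−(δ∕2)(|x − u′| + |z − u′|)}`. -/
theorem locStencil_slice {X : Tab d} {C δ : ℝ} (hX : LocStencil₂ X C δ) (hδ : 0 ≤ δ) (κ : Fin (d + 1)) (u : Site (d + 1)) :
    LocStencil (X κ u) C (δ / 2) := by
  have hC : 0 ≤ C := hX.nonneg
  intro κ' u' x z a b
  have h := hX κ u κ' u' x z a b
  have tx : l1 (x - u') ≤ l1 (x - u) + l1 (u - u') := l1_sub_triangle x u u'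
  have tz : l1 (z - u') ≤ l1 (z - u) + l1 (u - u') := l1_sub_triangle z u u'
  have hs : l1 (u - u') = l1 (u' - u) := l1_sub_symm u u'
  have h0 := l1_nonneg (x - u)
  have h1 := l1_nonneg (z - u)
  have h2 := l1_nonneg (u' - u)
  calc |X κ u κ' u' x z a b| ≤ C * Real.exp (-δ * l1 (u' - u)) * Real.exp (-δ * (l1 (x - u) + l1 (z - u))) := h
    _ = C * Real.exp (-δ * l1 (u' - u) + -δ * (l1 (x - u) + l1 (z - u))) := by rw [mul_assoc, ← Real.exp_add]
    _ ≤ C * Real.exp (-(δ / 2) * (l1 (x - u') + l1 (z - u'))) := by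
        refine mul_le_mul_of_nonneg_left (Real.exp_le_exp.2 ?_) hC
        rw [hs] at tx tz
        nlinarith

/-- [folklore] **CO-DRESSING THE KERNEL IS CO-PROJECTING THE STENCIL SLOT** (first order; an2's windowed adjunction `vertexOfK_coProjBmAtK` + `colH_coDressKBmAt_eq`,
restated with the co-dressed kernel on the left): for a decaying `K`, a local stencil family `S` and an in-block root,
`vertexOfK (coDressKBmAt ρ N K) N S μ y = vertexOfK K N (coProjBmAtK ρ N S) μ y`. -/
theorem vertexOfK_coDressKBmAt {N : ℕ} (hN : 1 ≤ N) {r : Fin (d + 1) → ℕ} (hr : r ∈ box (d + 1) N)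
    {K : MKer (d + 1) (Fib d)} {C m : ℝ} (hK : Decays K C m) (hm : 0 < m)
    {S : Fin (d + 1) → (Fin (d + 1) → ℤ) → MKer (d + 1) (Fib d)} {Cs δs : ℝ} (hS : LocStencil S Cs δs) (hδs : 0 ≤ δs)
    (μ : Fin (d + 1)) (y : Fin (d + 1) → ℤ) :
    vertexOfK (coDressKBmAt (toSite r) N K) N S μ y = vertexOfK K N (coProjBmAtK (toSite r) N S) μ y := by
  funext x z a b
  rw [vertexOfK_coProjBmAtK hN hr hK hm hS hδs]
  show ∑ κ' : Fin (d + 1), wsum (colH (coDressKBmAt (toSite r) N K) N μ y κ') (S κ') x z a b = _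
  rw [colH_coDressKBmAt_eq]


/-! ## §2 The table operations preserve `LocStencil₂`; finite linear combinations in the stencil slot -/

/-- [folklore] **CO-PROJECTING THE SECOND SOURCE SLOT PRESERVES `LocStencil₂`** (in-block root; window constant `cKb d N δ = cWb d N·e^{δ(d+1)N}`). -/
theorem locStencil₂_coProj_snd {N : ℕ} (hN : 1 ≤ N) {r : Fin (d + 1) → ℕ} (hr : r ∈ box (d + 1) N) {X : Tab d} {C δ : ℝ}
    (hX : LocStencil₂ X C δ) (hδ : 0 ≤ δ) :
    LocStencil₂ (fun κ u => coProjBmAtK (toSite r) N (X κ u)) (cKb d N δ * C) δ := by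
  have hC : 0 ≤ C := hX.nonneg
  intro κ u κ' u' x z a b
  show |coProjBmAtK (toSite r) N (X κ u) κ' u' x z a b| ≤ _
  rw [coProjBmAtK_eval]
  have hM : ∀ (β : Fin (d + 1)) (v : Fin (d + 1) → ℤ), v ∈ cube (d + 1) N →
      |X κ u β (u' + v) x z a b| ≤ C * Real.exp (δ * (((d : ℝ) + 1) * N)) * Real.exp (-δ * l1 (u' - u)) *
        Real.exp (-δ * (l1 (x - u) + l1 (z - u))) := by
    intro β v hv
    have hv' : l1 (u' - (u' + v)) ≤ ((d : ℝ) + 1) * N := by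
      rw [l1_sub_symm, add_sub_cancel_left]
      have h := l1_le_of_mem_cube hv
      push_cast at h
      exact h
    have t : l1 (u' - u) ≤ l1 (u' - (u' + v)) + l1 ((u' + v) - u) := l1_sub_triangle u' (u' + v) u
    have he : Real.exp (-δ * l1 ((u' + v) - u)) ≤ Real.exp (δ * (((d : ℝ) + 1) * N)) * Real.exp (-δ * l1 (u' - u)) := by
      rw [← Real.exp_add]
      exact Real.exp_le_exp.2 (by nlinarith)
    calc |X κ u β (u' + v) x z a b|
        ≤ C * Real.exp (-δ * l1 ((u' + v) - u)) * Real.exp (-δ * (l1 (x - u) + l1 (z - u))) := hX κ u β (u' + v) x z a b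
      _ ≤ C * (Real.exp (δ * (((d : ℝ) + 1) * N)) * Real.exp (-δ * l1 (u' - u))) * Real.exp (-δ * (l1 (x - u) + l1 (z - u))) :=
          mul_le_mul_of_nonneg_right (mul_le_mul_of_nonneg_left he hC) (Real.exp_pos _).le
      _ = _ := by ring
  calc |coProjBmAt (toSite r) N (fun κ₁ u₁ => X κ u κ₁ u₁ x z a b) κ' u'|
      ≤ cWb d N * (C * Real.exp (δ * (((d : ℝ) + 1) * N)) * Real.exp (-δ * l1 (u' - u)) *
          Real.exp (-δ * (l1 (x - u) + l1 (z - u)))) := abs_coProjBmAt_le hN hr _ κ' u' hM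
    _ = cKb d N δ * C * Real.exp (-δ * l1 (u' - u)) * Real.exp (-δ * (l1 (x - u) + l1 (z - u))) := by
        unfold cKb; ring

/-- [folklore] **CO-PROJECTING THE FIRST SOURCE SLOT PRESERVES `LocStencil₂`** (in-block root; the window moves the localisation centre by at most
`(d+1)N` in each of the three distances — constant `cWb d N·e^{3δ(d+1)N}`). -/
theorem locStencil₂_coProj_fst {N : ℕ} (hN : 1 ≤ N) {r : Fin (d + 1) → ℕ} (hr : r ∈ box (d + 1) N) {Y : Tab d} {C δ : ℝ}
    (hY : LocStencil₂ Y C δ) (hδ : 0 ≤ δ) :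
    LocStencil₂ (fun κ u κ' u' => coProjBmAtK (toSite r) N (fun κ₁ u₁ => Y κ₁ u₁ κ' u') κ u)
      (cWb d N * Real.exp (3 * δ * (((d : ℝ) + 1) * N)) * C) δ := by
  have hC : 0 ≤ C := hY.nonneg
  intro κ u κ' u' x z a b
  show |coProjBmAtK (toSite r) N (fun κ₁ u₁ => Y κ₁ u₁ κ' u') κ u x z a b| ≤ _
  rw [coProjBmAtK_eval]
  have hM : ∀ (β : Fin (d + 1)) (v : Fin (d + 1) → ℤ), v ∈ cube (d + 1) N →
      |Y β (u + v) κ' u' x z a b| ≤ C * Real.exp (3 * δ * (((d : ℝ) + 1) * N)) * Real.exp (-δ * l1 (u' - u)) *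
        Real.exp (-δ * (l1 (x - u) + l1 (z - u))) := by
    intro β v hv
    have hv' : l1 ((u + v) - u) ≤ ((d : ℝ) + 1) * N := by
      rw [add_sub_cancel_left]
      have h := l1_le_of_mem_cube hv
      push_cast at h
      exact h
    have t1 : l1 (u' - u) ≤ l1 (u' - (u + v)) + l1 ((u + v) - u) := l1_sub_triangle u' (u + v) u
    have t2 : l1 (x - u) ≤ l1 (x - (u + v)) + l1 ((u + v) - u) := l1_sub_triangle x (u + v) u
    have t3 : l1 (z - u) ≤ l1 (z - (u + v)) + l1 ((u + v) - u) := l1_sub_triangle z (u + v) u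
    calc |Y β (u + v) κ' u' x z a b|
        ≤ C * Real.exp (-δ * l1 (u' - (u + v))) * Real.exp (-δ * (l1 (x - (u + v)) + l1 (z - (u + v)))) :=
          hY β (u + v) κ' u' x z a b
      _ = C * Real.exp (-δ * l1 (u' - (u + v)) + -δ * (l1 (x - (u + v)) + l1 (z - (u + v)))) := by
          rw [mul_assoc, ← Real.exp_add]
      _ ≤ C * Real.exp (3 * δ * (((d : ℝ) + 1) * N) + (-δ * l1 (u' - u) + -δ * (l1 (x - u) + l1 (z - u)))) :=
          mul_le_mul_of_nonneg_left (Real.exp_le_exp.2 (by nlinarith)) hC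
      _ = _ := by rw [Real.exp_add, Real.exp_add]; ring
  calc |coProjBmAt (toSite r) N (fun κ₁ u₁ => Y κ₁ u₁ κ' u' x z a b) κ u|
      ≤ cWb d N * (C * Real.exp (3 * δ * (((d : ℝ) + 1) * N)) * Real.exp (-δ * l1 (u' - u)) *
          Real.exp (-δ * (l1 (x - u) + l1 (z - u)))) := abs_coProjBmAt_le hN hr _ κ u hM
    _ = cWb d N * Real.exp (3 * δ * (((d : ℝ) + 1) * N)) * C * Real.exp (-δ * l1 (u' - u)) *
          Real.exp (-δ * (l1 (x - u) + l1 (z - u))) := by ring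

/-- [folklore] **DRESSING THE KERNEL LEGS PRESERVES `LocStencil₂`** (an2's `biLoc_dressKBmAt`, constant `cKb²`). -/
theorem locStencil₂_dress {N : ℕ} (hN : 1 ≤ N) {r : Fin (d + 1) → ℕ} (hr : r ∈ box (d + 1) N) {T : Tab d} {C δ : ℝ}
    (hT : LocStencil₂ T C δ) (hδ : 0 ≤ δ) :
    LocStencil₂ (fun κ u κ' u' => dressKBmAt (toSite r) N (T κ u κ' u')) (cKb d N δ * cKb d N δ * C) δ := by
  intro κ u κ' u'
  have h := biLoc_dressKBmAt hN hr (hT κ u κ' u') hδ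
  have e : cKb d N δ * (cKb d N δ * (C * Real.exp (-δ * l1 (u' - u)))) = cKb d N δ * cKb d N δ * C * Real.exp (-δ * l1 (u' - u)) := by
    ring
  rw [e] at h
  exact h

/-- [folklore] **THE CHAIN-RULE VERTEX IS LINEAR IN ITS STENCIL SLOT** (finite linear combinations; each summand's weighted series summable). -/
theorem vertexOfK_finset_sum_mul {N : ℕ} {K : MKer (d + 1) (Fib d)} {ι : Type*} (s : Finset ι) (c : ι → ℝ)
    (T : ι → Fin (d + 1) → (Fin (d + 1) → ℤ) → MKer (d + 1) (Fib d)) (ν : Fin (d + 1)) (y' : Fin (d + 1) → ℤ)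
    (x z : Fin (d + 1) → ℤ) (a b : Fib d)
    (hs : ∀ i ∈ s, ∀ κ, Summable fun u => colH K N ν y' κ u * T i κ u x z a b) :
    vertexOfK K N (fun κ u => fun x z a b => ∑ i ∈ s, c i * T i κ u x z a b) ν y' x z a b
      = ∑ i ∈ s, c i * vertexOfK K N (T i) ν y' x z a b := by
  simp only [vertexOfK, wsum]
  have e1 : ∀ κ : Fin (d + 1), (∑' u, colH K N ν y' κ u * ∑ i ∈ s, c i * T i κ u x z a b)
      = ∑ i ∈ s, c i * ∑' u, colH K N ν y' κ u * T i κ u x z a b := by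
    intro κ
    have e2 : ∀ u, colH K N ν y' κ u * ∑ i ∈ s, c i * T i κ u x z a b
        = ∑ i ∈ s, c i * (colH K N ν y' κ u * T i κ u x z a b) := by
      intro u
      rw [Finset.mul_sum]
      exact Finset.sum_congr rfl fun i _ => by ring
    simp_rw [e2]
    rw [Summable.tsum_finsetSum (fun i hi => (hs i hi κ).mul_left (c i))]
    exact Finset.sum_congr rfl fun i _ => tsum_mul_left
  simp_rw [e1]
  rw [Finset.sum_comm]
  exact Finset.sum_congr rfl fun i _ => by rw [Finset.mul_sum]

/-- [folklore] **THE INNER VERTEX OF A SLICE IS A LOCAL STENCIL FAMILY** (an2's `biLoc_vertexOfK_slice` with the far-centre factor dropped):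
`κ u ↦ vertexOfK K N (T κ u) ν y′` is `LocStencil ((d+1)·C·C_T·Zl(m∕2)) m`. -/
theorem locStencil_vertexOfK_slice {N : ℕ} {K : MKer (d + 1) (Fib d)} {C m : ℝ} (hK : Decays K C m) (hm : 0 < m) {T : Tab d} {CT : ℝ}
    (hT : LocStencil₂ T CT m) (ν : Fin (d + 1)) (y' : Fin (d + 1) → ℤ) :
    LocStencil (fun κ u => vertexOfK K N (T κ u) ν y') ((d + 1 : ℕ) * (C * CT * Zl (d + 1) (m / 2))) m := by
  have hC : 0 ≤ C := hK.nonneg (Sum.inl 0)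
  have hCT : 0 ≤ CT := hT.nonneg
  have hm2 : 0 < m / 2 := half_pos hm
  intro κ u x z a b
  have h := biLoc_vertexOfK_slice (N := N) hK hC hT hm κ u ν y' x z a b
  have hZ := Zl_nonneg (D := d + 1) hm2
  have hK0 : 0 ≤ (d + 1 : ℕ) * (C * CT * Zl (d + 1) (m / 2)) := by positivity
  refine h.trans (mul_le_mul_of_nonneg_right ?_ (Real.exp_pos _).le)
  have he : Real.exp (-(m / 2) * l1 (u - (N : ℤ) • y')) ≤ 1 :=
    Real.exp_le_one_iff.2 (by nlinarith [l1_nonneg (u - (N : ℤ) • y')])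
  calc ((d + 1 : ℕ) : ℝ) * (C * CT * Zl (d + 1) (m / 2) * Real.exp (-(m / 2) * l1 (u - (N : ℤ) • y')))
      = (d + 1 : ℕ) * (C * CT * Zl (d + 1) (m / 2)) * Real.exp (-(m / 2) * l1 (u - (N : ℤ) • y')) := by ring
    _ ≤ (d + 1 : ℕ) * (C * CT * Zl (d + 1) (m / 2)) * 1 := mul_le_mul_of_nonneg_left he hK0
    _ = _ := mul_one _

/-! ## §3 The bi-vertex: both source slots are co-projected -/

/-- [folklore] **CO-DRESSING THE KERNEL IS CO-PROJECTING BOTH SOURCE SLOTS OF THE TABLE, inside the bi-vertex** (decaying `K`, `LocStencil₂` table at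
the same rate, in-block root):
`vertex2OfK (coDressKBmAt ρ N K) N X μ y ν y′ = vertex2OfK K N X̂ μ y ν y′`, `X̂ κ u κ′ u′ := coProjBmAtK ρ N (fun κ₁ u₁ ↦ coProjBmAtK ρ N (X κ₁ u₁) κ′ u′) κ u`
— the dressed `ℋ`-columns `colH (Πᵀ K Π) = Π_bm (colH K)` (`colH_coDressKBmAt_eq`) are moved onto the two slots they are contracted with by an2's windowed
adjunction (`vertexOfK_coProjBmAtK`), inner slot first; the kernel legs of `X` are untouched at this stage. -/
theorem vertex2OfK_coDressKBmAt {N : ℕ} (hN : 1 ≤ N) {r : Fin (d + 1) → ℕ} (hr : r ∈ box (d + 1) N)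
    {K : MKer (d + 1) (Fib d)} {C m : ℝ} (hK : Decays K C m) (hm : 0 < m) {X : Tab d} {CX : ℝ} (hX : LocStencil₂ X CX m)
    (μ : Fin (d + 1)) (y : Fin (d + 1) → ℤ) (ν : Fin (d + 1)) (y' : Fin (d + 1) → ℤ) :
    vertex2OfK (coDressKBmAt (toSite r) N K) N X μ y ν y'
      = vertex2OfK K N (fun κ u κ' u' => coProjBmAtK (toSite r) N (fun κ₁ u₁ => coProjBmAtK (toSite r) N (X κ₁ u₁) κ' u') κ u) μ y ν y' := by
  have hC : 0 ≤ C := hK.nonneg (Sum.inl 0)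
  have hCX : 0 ≤ CX := hX.nonneg
  have hm2 : 0 < m / 2 := half_pos hm
  -- the inner slices and their co-projections are local stencil families
  have hsl : ∀ κ u, LocStencil (X κ u) CX (m / 2) := fun κ u => locStencil_slice hX hm.le κ u
  have hsl' : ∀ κ u, LocStencil (coProjBmAtK (toSite r) N (X κ u)) (cKb' d N (m / 2) * CX) (m / 2) :=
    fun κ u => locStencil_coProjBmAtK hN hr (hsl κ u) hm2.le
  -- inner exchange, slot by slot
  have inner : (fun κ u => vertexOfK (coDressKBmAt (toSite r) N K) N (X κ u) ν y')
      = fun κ u => vertexOfK K N (coProjBmAtK (toSite r) N (X κ u)) ν y' :=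
    funext fun κ => funext fun u => vertexOfK_coDressKBmAt hN hr hK hm (hsl κ u) hm2.le ν y'
  -- the exchanged inner family is a local stencil family (from the `LocStencil₂` bound of the co-projected table)
  have hX' : LocStencil₂ (fun κ u => coProjBmAtK (toSite r) N (X κ u)) (cKb d N m * CX) m := locStencil₂_coProj_snd hN hr hX hm.le
  have hYloc : LocStencil (fun κ u => vertexOfK K N (coProjBmAtK (toSite r) N (X κ u)) ν y')
      ((d + 1 : ℕ) * (C * (cKb d N m * CX) * Zl (d + 1) (m / 2))) m := locStencil_vertexOfK_slice hK hm hX' ν y'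
  -- outer exchange
  unfold vertex2OfK
  rw [inner, vertexOfK_coDressKBmAt hN hr hK hm hYloc hm.le μ y]
  congr 1
  funext κ u x z a b
  -- the co-projection of the exchanged family is the vertex of the doubly co-projected table (linearity in the stencil slot)
  rw [coProjBmAtK_eval, coProjBmAt_apply]
  symm
  have hsum : ∀ v ∈ cube (d + 1) N, ∀ (β κ' : Fin (d + 1)),
      Summable fun u' => colH K N ν y' κ' u' * coProjBmAtK (toSite r) N (X β (u + v)) κ' u' x z a b :=
    fun v _ β κ' => summable_colH_mul_stencil hK hm.le (hsl' β (u + v)) hm2 κ' ν y' x z a b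
  have key := vertexOfK_finset_sum_mul (K := K) (N := N) ((cube (d + 1) N) ×ˢ (Finset.univ : Finset (Fin (d + 1))))
    (fun vβ => pmBm (toSite r) N vβ.2 (u + vβ.1) κ u) (fun vβ => coProjBmAtK (toSite r) N (X vβ.2 (u + vβ.1))) ν y' x z a b
    (fun vβ hvβ κ' => hsum vβ.1 (Finset.mem_product.1 hvβ).1 vβ.2 κ')
  have eT : (fun κ' u' => fun x z a b => ∑ vβ ∈ (cube (d + 1) N) ×ˢ (Finset.univ : Finset (Fin (d + 1))),
        pmBm (toSite r) N vβ.2 (u + vβ.1) κ u * coProjBmAtK (toSite r) N (X vβ.2 (u + vβ.1)) κ' u' x z a b)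
      = fun κ' u' => coProjBmAtK (toSite r) N (fun κ₁ u₁ => coProjBmAtK (toSite r) N (X κ₁ u₁) κ' u') κ u := by
    funext κ' u' x z a b
    rw [Finset.sum_product, coProjBmAtK_eval, coProjBmAt_apply]
  rw [eT] at key
  simpa only [Finset.sum_product] using key


/-! ## §4 The kernel legs: `linT2`, `vsym`, `lin4` — co-dressing the resolvent is dressing the table -/

/-- [folklore] The block-mean kernel dressing is additive. -/
theorem dressKBmAt_add (ρ : Fin (d + 1) → ℤ) (N : ℕ) (V W : MKer (d + 1) (Fib d)) :
    dressKBmAt ρ N (V + W) = dressKBmAt ρ N V + dressKBmAt ρ N W := by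
  have h1 : ∀ A B : MKer (d + 1) (Fib d),
      AxialDressingRooted.legCo₁BmAt ρ N (A + B) = AxialDressingRooted.legCo₁BmAt ρ N A + AxialDressingRooted.legCo₁BmAt ρ N B := by
    intro A B
    funext x y a b
    rcases a with α | m
    · simp only [Pi.add_apply, AxialDressingRooted.legCo₁BmAt_inl, coProjBmAt_apply, mul_add, Finset.sum_add_distrib]
    · rfl
  have h2 : ∀ A B : MKer (d + 1) (Fib d),
      AxialDressingRooted.legCo₂BmAt ρ N (A + B) = AxialDressingRooted.legCo₂BmAt ρ N A + AxialDressingRooted.legCo₂BmAt ρ N B := by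
    intro A B
    funext x y a b
    rcases b with β | m
    · simp only [Pi.add_apply, AxialDressingRooted.legCo₂BmAt_inl, coProjBmAt_apply, mul_add, Finset.sum_add_distrib]
    · rfl
  rw [AxialDressingRooted.dressKBmAt_eq_legs, AxialDressingRooted.dressKBmAt_eq_legs, AxialDressingRooted.dressKBmAt_eq_legs, h1, h2]

/-- [folklore] The block-mean kernel dressing is homogeneous (`•` form of an2's `dressKBmAt_mul_left`). -/
theorem dressKBmAt_smul (ρ : Fin (d + 1) → ℤ) (N : ℕ) (c : ℝ) (V : MKer (d + 1) (Fib d)) :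
    dressKBmAt ρ N (c • V) = c • dressKBmAt ρ N V := by
  funext x z a b
  have e : c • V = fun x z a b => c * V x z a b := rfl
  rw [e, AxialDressingRooted.dressKBmAt_mul_left ρ N c V x z a b]
  rfl

/-- [folklore] **THE BI-VERTEX OF A LEG-DRESSED TABLE IS THE LEG-DRESSED BI-VERTEX** (an2's `vertexOfK_dressKBmAt`, twice): for a decaying `K` and a
`LocStencil₂` table `T` at the same rate, `vertex2OfK K N (κ u κ′ u′ ↦ dressKBmAt ρ N (T κ u κ′ u′)) μ y ν y′ = dressKBmAt ρ N (vertex2OfK K N T μ y ν y′)`. -/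
theorem vertex2OfK_dress {N : ℕ} (ρ : Fin (d + 1) → ℤ) {K : MKer (d + 1) (Fib d)} {C m : ℝ} (hK : Decays K C m) (hm : 0 < m)
    {T : Tab d} {CT : ℝ} (hT : LocStencil₂ T CT m) (μ : Fin (d + 1)) (y : Fin (d + 1) → ℤ) (ν : Fin (d + 1)) (y' : Fin (d + 1) → ℤ) :
    vertex2OfK K N (fun κ u κ' u' => dressKBmAt ρ N (T κ u κ' u')) μ y ν y' = dressKBmAt ρ N (vertex2OfK K N T μ y ν y') := by
  have hm2 : 0 < m / 2 := half_pos hm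
  have inner : (fun κ u => vertexOfK K N (fun κ' u' => dressKBmAt ρ N (T κ u κ' u')) ν y')
      = fun κ u => dressKBmAt ρ N (vertexOfK K N (T κ u) ν y') :=
    funext fun κ => funext fun u => vertexOfK_dressKBmAt ρ N hK hm.le (locStencil_slice hT hm.le κ u) hm2 ν y'
  unfold vertex2OfK
  rw [inner, vertexOfK_dressKBmAt ρ N hK hm.le (locStencil_vertexOfK_slice hK hm hT ν y') hm μ y]

/-- [folklore] **CO-DRESSING THE RESOLVENT IS DRESSING THE TABLE, inside the linear second-order transport** (decaying `K`, `LocStencil₂` table at the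
same rate, in-block root `ρ = toSite r`, `1 ≤ N`):
`linT2 (coDressKBmAt ρ N K) N X = linT2 K N (𝔇 X)`, `𝔇 X κ u κ′ u′ := dressKBmAt ρ N (coProjBmAtK ρ N (fun κ₁ u₁ ↦ coProjBmAtK ρ N (X κ₁ u₁) κ′ u′) κ u)`
— both SOURCE slots co-projected by `Πᵀ_bm` (§3), then the outer co-dressing disappears under the `mm`-read and the KERNEL legs of the bi-vertex pick up
`Π_bm ∘ · ∘ Πᵀ_bm` (the row owner's `mmRead_sandwich_coDressKBmAt`), which commutes into the table (`vertex2OfK_dress`). -/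
theorem linT2_coDressKBmAt {N : ℕ} (hN : 1 ≤ N) {r : Fin (d + 1) → ℕ} (hr : r ∈ box (d + 1) N)
    {K : MKer (d + 1) (Fib d)} {C m : ℝ} (hK : Decays K C m) (hm : 0 < m) {X : Tab d} {CX : ℝ} (hX : LocStencil₂ X CX m) :
    linT2 (coDressKBmAt (toSite r) N K) N X
      = linT2 K N (fun κ u κ' u' => dressKBmAt (toSite r) N
          (coProjBmAtK (toSite r) N (fun κ₁ u₁ => coProjBmAtK (toSite r) N (X κ₁ u₁) κ' u') κ u)) := by
  have hC : 0 ≤ C := hK.nonneg (Sum.inl 0)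
  have hXh : LocStencil₂ (fun κ u κ' u' => coProjBmAtK (toSite r) N (fun κ₁ u₁ => coProjBmAtK (toSite r) N (X κ₁ u₁) κ' u') κ u)
      (cWb d N * Real.exp (3 * m * (((d : ℝ) + 1) * N)) * (cKb d N m * CX)) m :=
    locStencil₂_coProj_fst hN hr (locStencil₂_coProj_snd hN hr hX hm.le) hm.le
  funext μ y ν y'
  show mmRead N (comp (comp (coDressKBmAt (toSite r) N K) (vertex2OfK (coDressKBmAt (toSite r) N K) N X μ y ν y'))
      (coDressKBmAt (toSite r) N K)) = mmRead N (comp (comp K (vertex2OfK K N _ μ y ν y')) K)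
  rw [vertex2OfK_coDressKBmAt hN hr hK hm hX μ y ν y', vertex2OfK_dress (toSite r) hK hm hXh μ y ν y']
  have hSpr : Spr K := ⟨C, m, hm, hK⟩
  have hLoc : Loc (vertex2OfK K N
      (fun κ u κ' u' => coProjBmAtK (toSite r) N (fun κ₁ u₁ => coProjBmAtK (toSite r) N (X κ₁ u₁) κ' u') κ u) μ y ν y') :=
    ⟨_, _, _, _, by positivity, vertexFamily₂_vertex2OfK (N := N) hK hC hXh hm μ y ν y'⟩
  exact mmRead_sandwich_coDressKBmAt hN hr hSpr hLoc N

/-- [folklore] **THE SYMMETRISED BI-VERTEX** (leaf-04's `vsym`): `vsym (coDressKBmAt ρ N K) N X μ y ν y′ = vsym K N X̂ μ y ν y′` with `X̂` the doubly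
co-projected table of §3 (the kernel legs are untouched at this level). -/
theorem vsym_coDressKBmAt {N : ℕ} (hN : 1 ≤ N) {r : Fin (d + 1) → ℕ} (hr : r ∈ box (d + 1) N)
    {K : MKer (d + 1) (Fib d)} {C m : ℝ} (hK : Decays K C m) (hm : 0 < m) {X : Tab d} {CX : ℝ} (hX : LocStencil₂ X CX m)
    (μ : Fin (d + 1)) (y : Fin (d + 1) → ℤ) (ν : Fin (d + 1)) (y' : Fin (d + 1) → ℤ) :
    vsym (coDressKBmAt (toSite r) N K) N X μ y ν y'
      = vsym K N (fun κ u κ' u' => coProjBmAtK (toSite r) N (fun κ₁ u₁ => coProjBmAtK (toSite r) N (X κ₁ u₁) κ' u') κ u) μ y ν y' := by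
  unfold vsym
  rw [vertex2OfK_coDressKBmAt hN hr hK hm hX μ y ν y', vertex2OfK_coDressKBmAt hN hr hK hm hX ν y' μ y]

/-- [folklore] **CO-DRESSING THE RESOLVENT IS DRESSING THE TABLE, inside the linear part of the normalised `T₂` recursion** (leaf-04's `lin4`; decaying
`K`, `LocStencil₂` table at the same rate, in-block root, `1 ≤ N`, any `c`):
`lin4 c (coDressKBmAt ρ N K) N X = lin4 c K N (𝔇 X)` with the SAME leg-dressed table `𝔇 X` as in `linT2_coDressKBmAt`. -/
theorem lin4_coDressKBmAt {N : ℕ} (hN : 1 ≤ N) {r : Fin (d + 1) → ℕ} (hr : r ∈ box (d + 1) N)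
    {K : MKer (d + 1) (Fib d)} {C m : ℝ} (hK : Decays K C m) (hm : 0 < m) {X : Tab d} {CX : ℝ} (hX : LocStencil₂ X CX m) (c : ℝ) :
    lin4 c (coDressKBmAt (toSite r) N K) N X
      = lin4 c K N (fun κ u κ' u' => dressKBmAt (toSite r) N
          (coProjBmAtK (toSite r) N (fun κ₁ u₁ => coProjBmAtK (toSite r) N (X κ₁ u₁) κ' u') κ u)) := by
  have hC : 0 ≤ C := hK.nonneg (Sum.inl 0)
  have hXh : LocStencil₂ (fun κ u κ' u' => coProjBmAtK (toSite r) N (fun κ₁ u₁ => coProjBmAtK (toSite r) N (X κ₁ u₁) κ' u') κ u)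
      (cWb d N * Real.exp (3 * m * (((d : ℝ) + 1) * N)) * (cKb d N m * CX)) m :=
    locStencil₂_coProj_fst hN hr (locStencil₂_coProj_snd hN hr hX hm.le) hm.le
  have hSpr : Spr K := ⟨C, m, hm, hK⟩
  have hV : VertexFamily₂ (vertex2OfK K N
      (fun κ u κ' u' => coProjBmAtK (toSite r) N (fun κ₁ u₁ => coProjBmAtK (toSite r) N (X κ₁ u₁) κ' u') κ u)) N _ (m / 8) :=
    vertexFamily₂_vertex2OfK (N := N) hK hC hXh hm
  funext κ u κ' u'
  rw [T2RecursionAffine.lin4_apply, T2RecursionAffine.lin4_apply, vsym_coDressKBmAt hN hr hK hm hX κ u κ' u']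
  have hLoc : Loc (vsym K N
      (fun κ u κ' u' => coProjBmAtK (toSite r) N (fun κ₁ u₁ => coProjBmAtK (toSite r) N (X κ₁ u₁) κ' u') κ u) κ u κ' u') := by
    unfold vsym
    exact Loc.smul _ (Loc.add ⟨_, _, _, _, by positivity, hV κ u κ' u'⟩ ⟨_, _, _, _, by positivity, hV κ' u' κ u⟩)
  rw [mmRead_sandwich_coDressKBmAt hN hr hSpr hLoc N]
  congr 3
  -- `dressKBmAt` of the symmetrised bi-vertex is the symmetrised bi-vertex of the leg-dressed table
  unfold vsym
  rw [dressKBmAt_smul, dressKBmAt_add, ← vertex2OfK_dress (toSite r) hK hm hXh κ u κ' u', ← vertex2OfK_dress (toSite r) hK hm hXh κ' u' κ u]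


end Summit.QuantumFields.BalabanUV.Beta.GAN24.LinT2CoDressed

end
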